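import HarnessLib
import Summits.CriticalPhenomena.Ising3DConformalLimit.Theorems.HarmonicMomentsIsotropyTwoPointAsymptoticIsotropyPairKernel
import Summits.CriticalPhenomena.Ising3DConformalLimit.Theorems.HyperoctahedralRPExistsScaleCovariantLimitDyadicLimitContinuous

/-!
# Vague asymptotic isotropy of the critical `ℤ³` two-point function, XXVII:
# the kernel of a SUBSEQUENTIAL pair scaling limit — symmetries and reflection positivity
(route HarmonicMomentsIsotropy, support item stmt-CriticalPhenomena-6036 `TwoPointAsymptoticIsotropy`;
first file of the ray-regular-variation line of seat c4)

Let `u k → 0⁺` be ONE mesh sequence and let the renormalised critical pair correlator of the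
nearest-neighbour Ising model on `ℤ³` converge along it,
`TendstoLocallyUniformlyOn (fun k => rescaledCorrelator (criticalCorr 3) ρ 2 (u k)) S₂ atTop (NonCoincident 3 2)`
(any renormalisation `ρ`; such `S₂` are the cluster points produced by compactness, no full limit is
assumed). Put `K x = S₂ (0, x)`. This file proves the SEQUENTIAL forms of the kernel clauses of the
tree's `TwoPointKernelOfLimit` (route HyperoctahedralRP) and of the pair-only forms of file XI
(`…TwoPointAsymptoticIsotropyPairKernel`, full filter `𝓝[>] 0`):

* `seqLimit_coordPerm`, `seqLimit_signFlip`, `seqLimit_signedPerm` — a sequential limit (any arity) is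
  invariant under the signed coordinate permutations of `ℝ³` on non-coincident configurations; for
  the sign flips the configuration is first translated to a point none of whose coordinates lies on
  any of the countably many grids `u k · ℤ` (`exists_translate_generic`), where the floor anti-commutes
  with the flip up to the lattice shift `-1` (`latticeApprox_signFlip_generic`);
* `limit_two_eq_of_sub_seq`, `kernel_continuousOn_seq` — `S₂(p, q) = K(q − p)` and `K` is continuous
  off `0` (the tree's `seqLimit_translate`, `continuousOn_seqLimit`);
* `kernel_mirror_invariant_seq` — `K ∘ θ_n = K` for the nine lattice mirror normals `n ∈ {e_i, e_i ± e_j}`;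
* `kernel_mirrorRP_of_latticeRP_seq`, `kernel_nineMirror_seq` — `Σ c_a c_b K(p_a − θ_n p_b) ≥ 0` for
  points of the open half-space `⟨·, n⟩ > 0`: nine-mirror lattice reflection positivity
  (`criticalCorrNineMirrorRP_proof`, FILS 1978) passed to the limit along the sequence through the
  automatic continuity of `S₂`.

These are the `hmirror` and continuity inputs of nine-mirror RP rigidity (`HRP2Rigidity_of`) for
cluster points; the proofs are those of files XI / of `…HyperoctahedralRPTwoPointKernelOfLimitClauses`
with the filter `𝓝[>] 0` replaced by `atTop` along `u`.

References: J. Fröhlich, R. Israel, E. H. Lieb, B. Simon, Comm. Math. Phys. 62 (1978), §3 Thm. 3.1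
[FrohlichEtAl1978]; J. Glimm, A. Jaffe, *Quantum Physics* (1987), §10.4 [GlimmJaffeQP1987];
S. Friedli, Y. Velenik (CUP 2017), Thm. 3.17, Exercise 3.14 [FriedliVelenik2017]. No definitions are
introduced.
-/

noncomputable section

namespace Summit.CriticalPhenomena.Ising3DConformalLimit.HarmonicMomentsIsotropyTwoPoint.RayRV

open Literature.Probability.LatticeModels Literature.MathematicalPhysics.QuantumFieldTheory
open Filter Set
open scoped Topology InnerProductSpace
open Summit.CriticalPhenomena.Ising3DConformalLimit.MoebiusLimitExistsNegative
open Summit.CriticalPhenomena.Ising3DConformalLimit.HyperoctahedralRPTwoPoint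
open Summit.CriticalPhenomena.Ising3DConformalLimit.HyperoctahedralRPNineMirror
open Summit.CriticalPhenomena.Ising3DConformalLimit.Cruxes.ExistsScaleCovariantLimit.TwoHierarchies
  (continuousOn_seqLimit seqLimit_translate exists_translate_generic)

variable {ρ : ℝ → ℝ} {u : ℕ → ℝ} {n : ℕ} {Sn : (Fin n → EuclideanSpace ℝ (Fin 3)) → ℝ}
  {S2 : (Fin 2 → EuclideanSpace ℝ (Fin 3)) → ℝ}

/-! ### Signed coordinate permutations -/

/-- A sequential limit of the critical correlators (any arity, any renormalisation, any meshes) is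
invariant under the coordinate permutations of `ℝ³` on non-coincident configurations — the lattice
approximation commutes exactly with the permutation. [cite: FriedliVelenik2017, Exercise 3.14, p. 115] -/
theorem seqLimit_coordPerm
    (hconv : TendstoLocallyUniformlyOn (fun k => rescaledCorrelator (criticalCorr 3) ρ n (u k)) Sn atTop
      (NonCoincident 3 n))
    (π : Equiv.Perm (Fin 3)) {x : Fin n → EuclideanSpace ℝ (Fin 3)} (hx : x ∈ NonCoincident 3 n) :
    Sn (fun i => LinearIsometryEquiv.piLpCongrLeft 2 ℝ ℝ π (x i)) = Sn x := by
  have hRx := (map_mem_nonCoincident_iff (LinearIsometryEquiv.piLpCongrLeft 2 ℝ ℝ π) x).2 hx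
  have h1 := hconv.tendsto_at hRx
  have h2 := hconv.tendsto_at hx
  exact tendsto_nhds_unique (h1.congr fun k => rescaledCorrelator_coordPerm π n (u k) x) h2

/-- The lattice approximation of a sign-flipped point at a mesh `δ ≠ 0`, when no coordinate lies on
the grid `δ·ℤ`: flip the approximation and shift by `-1` in the flipped coordinates
(`⌊-a⌋ = -⌊a⌋ - 1` off the integers). [folklore] -/
theorem latticeApprox_signFlip_generic (ε : Fin 3 → ℤˣ)
    (R : EuclideanSpace ℝ (Fin 3) ≃ₗᵢ[ℝ] EuclideanSpace ℝ (Fin 3))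
    (hR : ∀ (p : EuclideanSpace ℝ (Fin 3)) (j : Fin 3), R p j = ((ε j : ℤ) : ℝ) * p j)
    {δ : ℝ} (hδ : δ ≠ 0) {p : EuclideanSpace ℝ (Fin 3)} (hp : ∀ (j : Fin 3) (m : ℤ), p j ≠ m * δ) :
    latticeApprox δ (R p) =
      Site.signedPerm 1 ε (latticeApprox δ p) + fun j => if ε j = -1 then -1 else 0 := by
  funext j
  rw [Pi.add_apply, signedPerm_one_apply, latticeApprox_apply, latticeApprox_apply, hR]
  rcases Int.units_eq_one_or (ε j) with h | h
  · rw [h, if_neg (by decide), Units.val_one, Int.cast_one, one_mul, one_mul, add_zero]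
  · have hnot : p j / δ ∉ Set.range ((↑) : ℤ → ℝ) := by
      rintro ⟨m, hm⟩
      exact hp j m (by rw [hm, div_mul_cancel₀ _ hδ])
    rw [h, if_pos rfl, Units.val_neg, Units.val_one, Int.cast_neg, Int.cast_one, neg_one_mul,
      neg_div, floor_neg_of_not_int hnot]
    ring

/-- Sign-flip invariance of a sequential limit at a configuration GENERIC for the meshes `u k` (no
coordinate on any grid `u k · ℤ`): the two zoom sequences agree termwise once `u k > 0`, by the
hyperoctahedral and translation invariance of the critical state.
[cite: FriedliVelenik2017, Exercise 3.14, p. 115] -/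
theorem seqLimit_signFlip_of_generic
    (hconv : TendstoLocallyUniformlyOn (fun k => rescaledCorrelator (criticalCorr 3) ρ n (u k)) Sn atTop
      (NonCoincident 3 n))
    (hu : ∀ᶠ k in atTop, 0 < u k)
    (ε : Fin 3 → ℤˣ) (R : EuclideanSpace ℝ (Fin 3) ≃ₗᵢ[ℝ] EuclideanSpace ℝ (Fin 3))
    (hR : ∀ (p : EuclideanSpace ℝ (Fin 3)) (j : Fin 3), R p j = ((ε j : ℤ) : ℝ) * p j)
    {x : Fin n → EuclideanSpace ℝ (Fin 3)} (hx : x ∈ NonCoincident 3 n)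
    (hgen : ∀ (k : ℕ) (i : Fin n) (j : Fin 3) (m : ℤ), x i j ≠ m * u k) :
    Sn (fun i => R (x i)) = Sn x := by
  have hRx := (map_mem_nonCoincident_iff R x).2 hx
  have h1 := hconv.tendsto_at hRx
  have h2 := hconv.tendsto_at hx
  refine tendsto_nhds_unique h1 (h2.congr' ?_)
  filter_upwards [hu] with k hk
  rw [rescaledCorrelator_apply, rescaledCorrelator_apply]
  congr 1
  have hcfg : (fun i => latticeApprox (u k) (R (x i))) =
      fun i => Site.signedPerm 1 ε (latticeApprox (u k) (x i)) +
        fun j => if ε j = -1 then -1 else 0 := by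
    funext i; exact latticeApprox_signFlip_generic ε R hR hk.ne' (hgen k i)
  rw [hcfg, criticalCorr_translate, criticalCorr_signedPerm]

/-- **A sequential limit of the critical correlators on `ℤ³` is invariant under the coordinate sign
flips of `ℝ³`** on non-coincident configurations (any arity, any renormalisation, any mesh sequence
`u k → 0⁺`): move to a generic translate (`exists_translate_generic`), flip there, and translate back
(`seqLimit_translate`). [cite: FriedliVelenik2017, Exercise 3.14, p. 115] -/
theorem seqLimit_signFlip (hu : Tendsto u atTop (𝓝[>] (0 : ℝ)))
    (hconv : TendstoLocallyUniformlyOn (fun k => rescaledCorrelator (criticalCorr 3) ρ n (u k)) Sn atTop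
      (NonCoincident 3 n))
    (ε : Fin 3 → ℤˣ) (R : EuclideanSpace ℝ (Fin 3) ≃ₗᵢ[ℝ] EuclideanSpace ℝ (Fin 3))
    (hR : ∀ (p : EuclideanSpace ℝ (Fin 3)) (j : Fin 3), R p j = ((ε j : ℤ) : ℝ) * p j)
    {x : Fin n → EuclideanSpace ℝ (Fin 3)} (hx : x ∈ NonCoincident 3 n) :
    Sn (fun i => R (x i)) = Sn x := by
  obtain ⟨w, hw⟩ := exists_translate_generic u x
  have hupos : ∀ᶠ k in atTop, 0 < u k := hu.eventually self_mem_nhdsWithin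
  have hxw : (fun i => x i + w) ∈ NonCoincident 3 n := (add_mem_nonCoincident_iff w x).2 hx
  have hRxw := (map_mem_nonCoincident_iff R (fun i => x i + w)).2 hxw
  -- `R (x i) = R (x i + w) + (-R w)`
  have hcfg : (fun i => R (x i)) = fun i => R (x i + w) + (-R w) := by
    funext i; rw [map_add]; abel
  rw [hcfg, seqLimit_translate hu hconv (-R w) hRxw,
    seqLimit_signFlip_of_generic hconv hupos ε R hR hxw hw, seqLimit_translate hu hconv w hx]

/-- A sequential limit is invariant under every signed coordinate permutation of `ℝ³`
(`(R p)_j = ε_j p_{π⁻¹ j}`) on non-coincident configurations.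
[cite: FriedliVelenik2017, Exercise 3.14, p. 115] -/
theorem seqLimit_signedPerm (hu : Tendsto u atTop (𝓝[>] (0 : ℝ)))
    (hconv : TendstoLocallyUniformlyOn (fun k => rescaledCorrelator (criticalCorr 3) ρ n (u k)) Sn atTop
      (NonCoincident 3 n))
    (π : Equiv.Perm (Fin 3)) (ε : Fin 3 → ℤˣ)
    (R : EuclideanSpace ℝ (Fin 3) ≃ₗᵢ[ℝ] EuclideanSpace ℝ (Fin 3))
    (hR : ∀ (p : EuclideanSpace ℝ (Fin 3)) (j : Fin 3), R p j = ((ε j : ℤ) : ℝ) * p (π.symm j))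
    {x : Fin n → EuclideanSpace ℝ (Fin 3)} (hx : x ∈ NonCoincident 3 n) :
    Sn (fun i => R (x i)) = Sn x := by
  set P := LinearIsometryEquiv.piLpCongrLeft 2 ℝ ℝ π with hP
  set Rε : EuclideanSpace ℝ (Fin 3) ≃ₗᵢ[ℝ] EuclideanSpace ℝ (Fin 3) := P.symm.trans R with hRε
  have hPsymm : ∀ (p : EuclideanSpace ℝ (Fin 3)) (l : Fin 3), P.symm p l = p (π l) := by
    intro p l
    rw [hP, LinearIsometryEquiv.piLpCongrLeft_symm, coordPerm_apply]
    simp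
  have hRε' : ∀ (p : EuclideanSpace ℝ (Fin 3)) (j : Fin 3), Rε p j = ((ε j : ℤ) : ℝ) * p j := by
    intro p j
    rw [hRε, LinearIsometryEquiv.trans_apply, hR, hPsymm, Equiv.apply_symm_apply]
  have hPx := (map_mem_nonCoincident_iff P x).2 hx
  have h1 : (fun i => R (x i)) = fun i => Rε (P (x i)) := by
    funext i
    rw [hRε, LinearIsometryEquiv.trans_apply, LinearIsometryEquiv.symm_apply_apply]
  rw [h1, seqLimit_signFlip hu hconv ε Rε hRε' hPx, seqLimit_coordPerm hconv π hx]

/-! ### The kernel of a sequential pair limit: difference form and continuity -/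

/-- A sequential pair limit is a function of the difference only: `S₂(p, q) = S₂(0, q − p)` for
`p ≠ q` (`seqLimit_translate`). [cite: FriedliVelenik2017, Thm. 3.17] -/
theorem limit_two_eq_of_sub_seq (hu : Tendsto u atTop (𝓝[>] (0 : ℝ)))
    (hconv2 : TendstoLocallyUniformlyOn (fun k => rescaledCorrelator (criticalCorr 3) ρ 2 (u k)) S2 atTop
      (NonCoincident 3 2))
    {p q : EuclideanSpace ℝ (Fin 3)} (hpq : p ≠ q) :
    S2 ![p, q] = S2 ![0, q - p] := by
  have hmem : (![0, q - p] : Fin 2 → EuclideanSpace ℝ (Fin 3)) ∈ NonCoincident 3 2 :=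
    zero_pair_mem_nonCoincident (sub_ne_zero.2 hpq.symm)
  have h := seqLimit_translate hu hconv2 p hmem
  have hcfg : (fun i => (![0, q - p] : Fin 2 → EuclideanSpace ℝ (Fin 3)) i + p) = ![p, q] := by
    funext i; fin_cases i <;> simp
  rw [hcfg] at h
  exact h

/-- The kernel `x ↦ S₂ (0, x)` of a sequential pair limit is continuous off the origin
(`continuousOn_seqLimit`). [cite: FriedliVelenik2017, Thm. 3.17] -/
theorem kernel_continuousOn_seq (hu : Tendsto u atTop (𝓝[>] (0 : ℝ)))
    (hconv2 : TendstoLocallyUniformlyOn (fun k => rescaledCorrelator (criticalCorr 3) ρ 2 (u k)) S2 atTop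
      (NonCoincident 3 2)) :
    ContinuousOn (fun x : EuclideanSpace ℝ (Fin 3) => S2 ![0, x]) {0}ᶜ :=
  (continuousOn_seqLimit hu hconv2).comp continuous_zeroPair.continuousOn
    fun _ hx => zero_pair_mem_nonCoincident hx

/-! ### (e) Invariance under the nine lattice mirrors -/

/-- The kernel of a sequential pair limit is invariant under the nine lattice mirrors `e_i`,
`e_i ± e_j` (the reflections are signed coordinate permutations).
[cite: FriedliVelenik2017, Exercise 3.14, p. 115] -/
theorem kernel_mirror_invariant_seq (hu : Tendsto u atTop (𝓝[>] (0 : ℝ)))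
    (hconv2 : TendstoLocallyUniformlyOn (fun k => rescaledCorrelator (criticalCorr 3) ρ 2 (u k)) S2 atTop
      (NonCoincident 3 2))
    {n : EuclideanSpace ℝ (Fin 3)}
    (hn : ∃ i j : Fin 3, i ≠ j ∧ (n = EuclideanSpace.single i 1 ∨
      n = EuclideanSpace.single i 1 + EuclideanSpace.single j 1 ∨
      n = EuclideanSpace.single i 1 - EuclideanSpace.single j 1))
    (x : EuclideanSpace ℝ (Fin 3)) :
    S2 ![0, (ℝ ∙ n)ᗮ.reflection x] = S2 ![0, x] := by
  by_cases hx : x = 0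
  · subst hx
    simp
  obtain ⟨π, ε, hR⟩ := exists_signedPerm_of_latticeNormal hn
  have h := seqLimit_signedPerm hu hconv2 π ε ((ℝ ∙ n)ᗮ.reflection) hR (zero_pair_mem_nonCoincident hx)
  rwa [comp_zeroPair (map_zero _)] at h

/-! ### (f) Lattice reflection positivity passes to a sequential pair limit -/

/-- **Lattice reflection positivity passes to a sequential pair limit.** If the critical lattice
two-point function is reflection positive for a lattice realisation `θ'` of the mirror `θ_n` on finite
families of sites strictly inside the integer half-space `{ℓ > 0}` realising `⟨·, n⟩ > 0`, then the
kernel of any sequential pair limit satisfies `Σ c_a c_b S₂(0, p_a − θ_n p_b) ≥ 0` for points of the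
open half-space (approximation of `p_a` by rescaled sites at the meshes `u k`, `ρ(u k)² ≥ 0`, and
passage to the limit through the automatic continuity of `S₂`).
[cite: GlimmJaffeQP1987, §10.4, Remark after Thm. 10.4.3] -/
theorem kernel_mirrorRP_of_latticeRP_seq (hu : Tendsto u atTop (𝓝[>] (0 : ℝ)))
    (hconv2 : TendstoLocallyUniformlyOn (fun k => rescaledCorrelator (criticalCorr 3) ρ 2 (u k)) S2 atTop
      (NonCoincident 3 2))
    (n : EuclideanSpace ℝ (Fin 3)) (θ' : Site 3 → Site 3) (ℓ : Site 3 → ℤ)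
    (hθ' : ∀ y, siteVec (θ' y) = (ℝ ∙ n)ᗮ.reflection (siteVec y))
    (hℓ : ∀ y, (ℓ y : ℝ) = ⟪siteVec y, n⟫_ℝ)
    (hRP : ∀ (m : ℕ) (y : Fin m → Site 3) (c : Fin m → ℝ), (∀ a, 0 < ℓ (y a)) →
      0 ≤ ∑ a, ∑ b, c a * c b * criticalCorr 3 2 ![θ' (y a), y b])
    (m : ℕ) (p : Fin m → EuclideanSpace ℝ (Fin 3)) (c : Fin m → ℝ)
    (hp : ∀ a, 0 < ⟪p a, n⟫_ℝ) :
    0 ≤ ∑ a, ∑ b, c a * c b * S2 ![0, p a - (ℝ ∙ n)ᗮ.reflection (p b)] := by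
  set θ := (ℝ ∙ n)ᗮ.reflection with hθdef
  have hupos : ∀ᶠ k in atTop, 0 < u k := hu.eventually self_mem_nhdsWithin
  -- the reflected points lie strictly on the other side
  have hne : ∀ a b, θ (p a) ≠ p b := by
    intro a b h
    have h1 : ⟪θ (p a), n⟫_ℝ = -⟪p a, n⟫_ℝ := inner_mirrorReflection_normal n (p a)
    have h2 := hp a
    have h3 := hp b
    rw [h] at h1
    linarith
  -- Step 1: the target sum is `Σ c_a c_b S₂ (θ p_a, p_b)`
  have hsum : ∑ a, ∑ b, c a * c b * S2 ![0, p a - θ (p b)] =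
      ∑ a, ∑ b, c a * c b * S2 ![θ (p a), p b] := by
    rw [Finset.sum_comm]
    refine Finset.sum_congr rfl fun a _ => Finset.sum_congr rfl fun b _ => ?_
    rw [limit_two_eq_of_sub_seq hu hconv2 (hne a b), mul_comm (c b) (c a)]
  rw [hsum]
  -- Step 2: the approximants along the meshes `u k` and their limits
  set y : ℕ → Fin m → Site 3 := fun k a => latticeApprox (u k) (p a) with hy
  set T : ℕ → Fin m → Fin m → ℝ := fun k a b =>
    rescaledCorrelator (criticalCorr 3) ρ 2 (u k)
      (![u k • siteVec (θ' (y k a)), u k • siteVec (y k b)] : Fin 2 → EuclideanSpace ℝ (Fin 3)) with hT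
  have hTlim : ∀ a b, Tendsto (fun k => T k a b) atTop (𝓝 (S2 ![θ (p a), p b])) := by
    intro a b
    have hmem : (![θ (p a), p b] : Fin 2 → EuclideanSpace ℝ (Fin 3)) ∈ NonCoincident 3 2 :=
      HyperoctahedralRPTwoPoint.pair_mem_nonCoincident (hne a b)
    have hcont : ContinuousWithinAt S2 (NonCoincident 3 2) ![θ (p a), p b] :=
      continuousOn_seqLimit hu hconv2 _ hmem
    have ha : Tendsto (fun k => u k • siteVec (θ' (y k a))) atTop (𝓝 (θ (p a))) := by
      have h1 : ∀ k, u k • siteVec (θ' (y k a)) = θ (u k • siteVec (y k a)) := fun k => by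
        rw [hθ', LinearIsometryEquiv.map_smul]
      simp_rw [h1]
      exact (θ.continuous.tendsto _).comp ((tendsto_smul_siteVec_latticeApprox (p a)).comp hu)
    have hb : Tendsto (fun k => u k • siteVec (y k b)) atTop (𝓝 (p b)) :=
      (tendsto_smul_siteVec_latticeApprox (p b)).comp hu
    have hZ : Tendsto (fun k =>
        (![u k • siteVec (θ' (y k a)), u k • siteVec (y k b)] : Fin 2 → EuclideanSpace ℝ (Fin 3)))
        atTop (𝓝 ![θ (p a), p b]) := by
      rw [tendsto_pi_nhds]
      intro i
      fin_cases i
      · simpa using ha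
      · simpa using hb
    have hZ' : Tendsto (fun k =>
        (![u k • siteVec (θ' (y k a)), u k • siteVec (y k b)] : Fin 2 → EuclideanSpace ℝ (Fin 3)))
        atTop (𝓝[NonCoincident 3 2] ![θ (p a), p b]) :=
      tendsto_nhdsWithin_of_tendsto_nhds_of_eventually_within _ hZ
        (hZ.eventually ((isOpen_nonCoincident 3 2).mem_nhds hmem))
    exact hconv2.tendsto_comp hcont hmem hZ'
  -- Step 3: eventually every lattice point is strictly on the positive side
  have hpos : ∀ᶠ k in atTop, ∀ a, 0 < ℓ (y k a) := by
    refine eventually_all.2 fun a => ?_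
    have hcont : Continuous fun q : EuclideanSpace ℝ (Fin 3) => ⟪q, n⟫_ℝ :=
      continuous_id.inner continuous_const
    have ht : Tendsto (fun k => ⟪u k • siteVec (y k a), n⟫_ℝ) atTop (𝓝 ⟪p a, n⟫_ℝ) :=
      (hcont.tendsto _).comp ((tendsto_smul_siteVec_latticeApprox (p a)).comp hu)
    filter_upwards [ht.eventually (lt_mem_nhds (hp a)), hupos] with k hk hkpos
    rw [real_inner_smul_left, ← hℓ] at hk
    have h' : (0:ℝ) < ℓ (y k a) := pos_of_mul_pos_right hk (le_of_lt hkpos)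
    exact_mod_cast h'
  -- Step 4: eventually the approximating sums are `ρ(u k)² · (lattice RP sum) ≥ 0`
  have hTsum : ∀ᶠ k in atTop, 0 ≤ ∑ a, ∑ b, c a * c b * T k a b := by
    filter_upwards [hpos, hupos] with k hk hkpos
    have hrw : ∑ a, ∑ b, c a * c b * T k a b =
        ρ (u k) ^ 2 * ∑ a, ∑ b, c a * c b * criticalCorr 3 2 ![θ' (y k a), y k b] := by
      rw [Finset.mul_sum]
      refine Finset.sum_congr rfl fun a _ => ?_
      rw [Finset.mul_sum]
      refine Finset.sum_congr rfl fun b _ => ?_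
      rw [hT]
      simp only []
      rw [rescaledCorrelator_two_smul_siteVec ρ hkpos]
      ring
    rw [hrw]
    exact mul_nonneg (sq_nonneg _) (hRP m (y k) c hk)
  -- Step 5: pass to the limit
  have hlimsum : Tendsto (fun k => ∑ a, ∑ b, c a * c b * T k a b) atTop
      (𝓝 (∑ a, ∑ b, c a * c b * S2 ![θ (p a), p b])) :=
    tendsto_finsetSum _ fun a _ => tendsto_finsetSum _ fun b _ => (hTlim a b).const_mul _
  exact ge_of_tendsto hlimsum hTsum

/-- **The kernel of ANY sequential pair scaling limit of the critical `ℤ³` Ising two-point function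
is invariant and reflection positive with respect to each of the nine lattice mirrors `e_i, e_i ± e_j`**
— whatever the renormalisation and the mesh sequence, with no non-degeneracy or covariance
hypothesis: lattice reflection positivity (FILS 1978, `criticalCorrNineMirrorRP_proof`) passes to the
limit. This is the `hmirror` input of nine-mirror RP rigidity `HRP2Rigidity_of` for cluster points.
[cite: FrohlichEtAl1978, §3 Thm 3.1] -/
theorem kernel_nineMirror_seq (hu : Tendsto u atTop (𝓝[>] (0 : ℝ)))
    (hconv2 : TendstoLocallyUniformlyOn (fun k => rescaledCorrelator (criticalCorr 3) ρ 2 (u k)) S2 atTop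
      (NonCoincident 3 2))
    {n : EuclideanSpace ℝ (Fin 3)}
    (hn : ∃ i j : Fin 3, i ≠ j ∧ (n = EuclideanSpace.single i 1 ∨
      n = EuclideanSpace.single i 1 + EuclideanSpace.single j 1 ∨
      n = EuclideanSpace.single i 1 - EuclideanSpace.single j 1)) :
    (∀ x : EuclideanSpace ℝ (Fin 3), S2 ![0, (ℝ ∙ n)ᗮ.reflection x] = S2 ![0, x]) ∧
    (∀ (m : ℕ) (p : Fin m → EuclideanSpace ℝ (Fin 3)) (c : Fin m → ℝ), (∀ a, 0 < inner ℝ (p a) n) →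
      0 ≤ ∑ a, ∑ b, c a * c b * S2 ![0, p a - (ℝ ∙ n)ᗮ.reflection (p b)]) := by
  refine ⟨kernel_mirror_invariant_seq hu hconv2 hn, ?_⟩
  have hNine := criticalCorrNineMirrorRP_proof
  obtain ⟨i, j, hij, rfl | rfl | rfl⟩ := hn
  · exact kernel_mirrorRP_of_latticeRP_seq hu hconv2 _ (fun y => Function.update y i (-y i))
      (fun y => y i) (siteVec_coordMirror i) (level_coordMirror i)
      (latticeRP_two_of_nine hNine _ _ ⟨i, j, hij, Or.inl ⟨rfl, rfl⟩⟩)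
  · exact kernel_mirrorRP_of_latticeRP_seq hu hconv2 _
      (fun y => Function.update (Function.update y i (-y j)) j (-y i)) (fun y => y i + y j)
      (siteVec_antiMirror hij) (level_antiMirror i j)
      (latticeRP_two_of_nine hNine _ _ ⟨i, j, hij, Or.inr (Or.inr ⟨rfl, rfl⟩)⟩)
  · exact kernel_mirrorRP_of_latticeRP_seq hu hconv2 _ (fun y => y ∘ Equiv.swap i j)
      (fun y => y i - y j) (siteVec_swapMirror hij) (level_swapMirror i j)
      (latticeRP_two_of_nine hNine _ _ ⟨i, j, hij, Or.inr (Or.inl ⟨rfl, rfl⟩)⟩)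

end Summit.CriticalPhenomena.Ising3DConformalLimit.HarmonicMomentsIsotropyTwoPoint.RayRV

end
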